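import Mathlib
import Summits.Ventures.HodgeRepro2.Tier7.Target
import Summits.Ventures.HodgeRepro2.Tier7.Line3.Defs

/-!
# Tier7/Line3/Shadow — the two-torus relative trace formula as a typed shadow, and the named obligation shape `RealShadow D`
(`RealShadow D ↔ RtfConclusion D` on every datum — NOT a stronger residual)
(t7-plan-3; lead l. 14836 (1): «spelled in Lean by plan-3 as ONE def `Line3.RealShadow D : Prop` (the real carriers' fields
displayed; no fabricated sw) with the landed chain `RealShadow D → RtfConclusion D → ∃ g, …`»).

Two layers, both sorry-free:
1. `RtfShadow Rep Orb PA PB` — the RTF's two sides over labels `Rep` (automorphic representations), `Orb` (double cosets),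
   period predicates `PA`, `PB`; the chain `exists_twoTorus : ∃ π, PA π ∧ PB π` (= route/t7/Line3/RtfShadow.lean v2,
   crit-2 l. 14783 / crit-1 l. 14794 CLEARED).
2. `RealShadowData D` — THE NAMED OBLIGATION SHAPE (lead l. 14881; crit-2 l. 14884; crit-1 l. 14886): the seesaw data
   of the datum (`SeesawData D`: spectrum `Rep`, theta lifts `Θ`, isotypic projections `comp` — F1/F2), two period
   predicates `perA`, `perB` with the seesaw identities (Kudla 1984 + Howe duality — F3, as iffs), and an `RtfShadow` over
   these carriers; `RealShadow D := Nonempty (RealShadowData D)`.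
   AS A PROP IT IS EQUIVALENT TO `RtfConclusion D` ON EVERY DATUM — `realShadow_iff_rtfConclusion` below (the converse is
   the one-point shadow `RtfShadow.trivial`: crit-1's construction, l. 14886, pasted with credit; the lead l. 14881 and
   crit-2 l. 14884 give the same) — so it is NOT a stronger residual: the carriers `Rep, Orb, perA, perB, spec, orb` are
   existentially bound and nothing in the type ties them to the real objects. THE CONTENT LIVES IN THE FIELDS FOR THE REAL
   CARRIERS: for the specific instance over X (Rep = the discrete spectrum of `U(W_A)` seen in `H^{2,0}(X_∞)`, Θ = the
   theta-isotypic parts, perA/perB = the toric periods of `(T_A, μ_A)`, `(T_B, μ_B)`, Orb = `T_A(F)\U(W_A)(F)/T_B(F)`,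
   spec/orb = the two sides of Getz–Hahn 2024 GTM 300 Cor. 18.3.1 p.371 = Jacquet's RTF, specialised to the anisotropic
   `U(W_A)` — lit-4 l. 14862), `identity` / `spec_summable` / the finiteness of `geomSupp` are PRINTED (ibid. Thm 18.2.2,
   Lemma 18.2.3, Thm 16.2.5), `seesawA/B` printed (Kudla 1984 + Howe), and the two fields `shrink` (isolation of one regular
   double coset by the test function) and `orb_γ₀` (`RO_{γ₀}(f) = ∏_v RO_{γ₀}(f_v) ≠ 0`) are NOT printed and not derivable
   from displayed hypotheses — they are Line 3's residual, stated in words (L3-ARGUMENT.md §2d) because X itself is not typed.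
   CHAIN (sorry-free, trio): `rtfConclusion_of_realShadow : RealShadow D → RtfConclusion D`,
   `exists_translates_of_realShadow : RealShadow D → ∃ g, D.S.L2 (D.fOmegaS g) (D.fOmegaSbar g) ≠ 0` (through the landed
   per-datum bridge `exists_translates_of`, p661163), `realShadow_of_rtfConclusion`, `realShadow_iff_rtfConclusion`,
   `not_realShadow_of_not_rtfConclusion`. Per-datum test: (i) `¬ RealShadow datumJ` and (iii) `RealShadow datumA` both
   follow from the iff and the landed facts about `RtfConclusion` (crit-1's `not_rtfConclusion_datumJ`, p1's
   `rtfConclusion_datumA`); (ii) ≡ `RtfConclusion D`, hence ≡ `CommonIrred D` ≡ `C(D)` on bridge data (RtfBridge, FDConverse).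
-/

namespace Summit.Ventures.HodgeRepro2.Tier7

open Summit.Ventures.HodgeRepro2.T6

noncomputable section

namespace Line3

/-! ## 1. The RTF shadow

# RtfShadow — the two-torus relative trace formula's GEOMETRIC SIDE as a typed shadow (t7-plan-3 DRAFT v2, 2026-08-28T20:1xZ — spectral side re-typed as `∑'` after crit-1 l. 14785; no gate call)

Line 3 (L3-ARGUMENT.md §2): for a family of test functions `f_N` on `U(W_A)(𝔸)` (varying only at one finite place `v₁`,
support shrinking to the isolated regular double coset `γ₀`), the relative trace formula for the two tori `(T_A, μ_A)`,
`(T_B, μ_B)` reads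
   `Σ_{γ ∈ T_A(F)\U(W_A)(F)/T_B(F)} O_γ(f_N) = Σ_π Σ_{φ ∈ ONB(π)} P_A(R(f_N)φ) · conj P_B(φ)`.
The shadow below records exactly the data the argument uses, each field with its provenance; the lemma chain after it
is SORRY-FREE. The FIRST LEMMA WHOSE HYPOTHESES ARE PRINTED is the identity itself (field `identity`): its hypotheses are
(a) the discrete decomposition of `L²([U(W_A)])` with finite multiplicities and absolutely convergent kernel expansion —
GGPS ch. 1 §2 = Deitmar–Echterhoff Thm 9.2.2 (C-L4-20) for the COMPACT quotient (U(W_A) anisotropic: Borel–Harish-Chandra /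
Godement), (b) compactness of `[T_A]`, `[T_B]` (E′¹ anisotropic), (c) Fubini for a bounded continuous integrand on a compact
product. The spectral side is typed as a `∑'` over the whole discrete spectrum (infinitely many `π`; `spec_summable` records the
absolute convergence and is not used by the chain — crit-1 l. 14785). The REMAINING fields are the arithmetic of §2
(derived, not printed): the finite geometric support (`orb_supp`: compact support of `f_N` + discreteness of
`U(W_A)(F)` + compact `[T_A] × [T_B]`), the isolation data (`anti`,
`shrink`: closedness of the regular double cosets + p1's κ-separation `exists_double_coset_of_kappa_eq`), and the single
non-zero term (`orb_γ₀`: a finite product of non-zero local orbital integrals — §2c split / inert / `v ∈ S` small support /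
§4a archimedean with p1's T5Bergman rows). `spec_zero_A/B` are the definition of the spectral term.
-/

/-- The RTF shadow over the labels `Rep` (automorphic representations of `U(W_A)` with the prescribed central
character), `Orb` (double cosets `T_A(F)\U(W_A)(F)/T_B(F)`), and the two period predicates `PA`, `PB` (the
`(T_A, μ_A)`- resp. `(T_B, μ_B)`-period of `π` is non-zero). -/
structure RtfShadow (Rep Orb : Type) (PA PB : Rep → Prop) where
  /-- spectral term of `f_N` at `π`: `Σ_{φ ∈ ONB(π)} P_A(R(f_N)φ) · conj P_B(φ)`. -/
  spec : ℕ → Rep → ℂ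
  /-- the spectral side is an ABSOLUTELY CONVERGENT series over the (infinitely many) `π` of the discrete spectrum
  (DE Thm 9.2.2 / BW VII 3.1: finite multiplicities per `π`, `R(f_N)` trace class on the compact quotient); recorded for
  faithfulness — the chain below does not use it (`∑'` needs only «all terms zero ⇒ sum zero»). -/
  spec_summable : ∀ N, Summable (spec N)
  /-- definition of the term: it vanishes when `P_A|_π = 0`. -/
  spec_zero_A : ∀ N π, ¬ PA π → spec N π = 0
  /-- definition of the term: it vanishes when `P_B|_π = 0`. -/
  spec_zero_B : ∀ N π, ¬ PB π → spec N π = 0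
  /-- orbital integral `O_γ(f_N)`. -/
  orb : ℕ → Orb → ℂ
  /-- the finitely many double cosets meeting the support of `f_N` (compact support + discreteness). -/
  geomSupp : ℕ → Finset Orb
  orb_supp : ∀ N γ, γ ∉ geomSupp N → orb N γ = 0
  /-- THE RELATIVE TRACE FORMULA (printed hypotheses (a)–(c) of the module docstring). -/
  identity : ∀ N, ∑ γ ∈ geomSupp N, orb N γ = ∑' π, spec N π
  /-- the isolated regular double coset. -/
  γ₀ : Orb
  /-- the supports shrink with `N` (the `f_N` are nested at `v₁`). -/
  anti : Antitone geomSupp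
  /-- isolation: only `γ₀` survives in every support (closed regular double cosets + κ-separation). -/
  shrink : ∀ γ, (∀ N, γ ∈ geomSupp N) → γ = γ₀
  /-- the isolated term is non-zero: a finite product of non-zero local orbital integrals. -/
  orb_γ₀ : ∀ N, orb N γ₀ ≠ 0

namespace RtfShadow

variable {Rep Orb : Type} {PA PB : Rep → Prop}

/-- every finite set of non-isolated double cosets eventually leaves the support. -/
theorem eventually_not_mem (sh : RtfShadow Rep Orb PA PB) (s : Finset Orb) (hs : ∀ γ ∈ s, γ ≠ sh.γ₀) :
    ∃ N, ∀ γ ∈ s, γ ∉ sh.geomSupp N := by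
  classical
  induction s using Finset.induction_on with
  | empty => exact ⟨0, by simp⟩
  | insert a s ha ih =>
    obtain ⟨N₁, hN₁⟩ := ih (fun γ hγ => hs γ (Finset.mem_insert_of_mem hγ))
    have ha' : a ≠ sh.γ₀ := hs a (Finset.mem_insert_self a s)
    have hna : ¬ ∀ N, a ∈ sh.geomSupp N := fun h => ha' (sh.shrink a h)
    obtain ⟨N₂, hN₂⟩ := not_forall.1 hna
    refine ⟨max N₁ N₂, ?_⟩
    intro γ hγ
    rcases Finset.mem_insert.1 hγ with rfl | hγs
    · exact fun hmem => hN₂ (sh.anti (le_max_right N₁ N₂) hmem)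
    · exact fun hmem => hN₁ γ hγs (sh.anti (le_max_left N₁ N₂) hmem)

/-- ISOLATION: for some `N` the geometric side has at most the term `γ₀`. -/
theorem exists_isolated (sh : RtfShadow Rep Orb PA PB) : ∃ N, sh.geomSupp N ⊆ {sh.γ₀} := by
  classical
  obtain ⟨N, hN⟩ := sh.eventually_not_mem ((sh.geomSupp 0).erase sh.γ₀)
    (fun γ hγ => (Finset.mem_erase.1 hγ).1)
  refine ⟨N, fun γ hγ => ?_⟩
  rw [Finset.mem_singleton]
  by_contra hne
  have h0 : γ ∈ sh.geomSupp 0 := sh.anti (Nat.zero_le N) hγ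
  exact hN γ (Finset.mem_erase.2 ⟨hne, h0⟩) hγ

/-- the isolated geometric side is the single non-zero term. -/
theorem exists_geom_ne_zero (sh : RtfShadow Rep Orb PA PB) : ∃ N, ∑ γ ∈ sh.geomSupp N, sh.orb N γ ≠ 0 := by
  classical
  obtain ⟨N, hN⟩ := sh.exists_isolated
  refine ⟨N, ?_⟩
  by_cases hmem : sh.γ₀ ∈ sh.geomSupp N
  · have heq : sh.geomSupp N = {sh.γ₀} :=
      Finset.Subset.antisymm hN (Finset.singleton_subset_iff.2 hmem)
    rw [heq, Finset.sum_singleton]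
    exact sh.orb_γ₀ N
  · exact absurd (sh.orb_supp N sh.γ₀ hmem) (sh.orb_γ₀ N)

/-- the spectral side is non-zero for that `N`, hence some spectral term is (no convergence input: a `∑'` all of
whose terms vanish is `0`). -/
theorem exists_spec_ne_zero (sh : RtfShadow Rep Orb PA PB) : ∃ N π, sh.spec N π ≠ 0 := by
  obtain ⟨N, hN⟩ := sh.exists_geom_ne_zero
  rw [sh.identity N] at hN
  by_contra hall
  have h0 : sh.spec N = 0 := funext (fun π => by
    by_contra hπ
    exact hall ⟨N, π, hπ⟩)
  exact hN (by rw [h0]; exact tsum_zero)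

/-- **THE TWO-TORUS CONCLUSION** (sorry-free over the shadow): some `π` has both toric periods non-zero. -/
theorem exists_twoTorus (sh : RtfShadow Rep Orb PA PB) : ∃ π, PA π ∧ PB π := by
  obtain ⟨N, π, hπ⟩ := sh.exists_spec_ne_zero
  refine ⟨π, ?_, ?_⟩
  · by_contra h; exact hπ (sh.spec_zero_A N π h)
  · by_contra h; exact hπ (sh.spec_zero_B N π h)

end RtfShadow


/-! ## 2. The named obligation shape: the RTF shadow over the datum's seesaw carriers (`RealShadow D ↔ RtfConclusion D`) -/

variable {K : Type} [Field K] [NumberField K] {E' : Type} [Field E'] [NumberField E']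
  {V : Type} [AddCommGroup V] [Module E' V] {HX : Type} [Ring HX] [Algebra ℂ HX]
  {G : Type} [Group G] [MulAction G HX]
variable (D : PeriodDatum K E' V HX G)

/-- The obligation shape: seesaw data (spectrum, theta lifts, isotypic projections — F1/F2), two period predicates with
the seesaw identities (F3, Kudla 1984 + Howe duality, as iffs), and an RTF shadow over these carriers. The carriers are
existentially bound in `RealShadow`; the type does not tie them to the real objects (`realShadow_iff_rtfConclusion`). -/
structure RealShadowData extends SeesawData D where
  /-- the `(T_A, μ_A)`-period of `π` is non-zero (a predicate; no value stated). -/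
  perA : Rep → Prop
  /-- the `(T_B, μ_B)`-period of `π` is non-zero. -/
  perB : Rep → Prop
  /-- seesaw (Kudla 1984) + Howe duality: the `Θ π`-component of some A-product translate is non-zero iff the
  `(T_A, μ_A)`-period of `π` is non-zero and `Θ π ≠ ⊥`. -/
  seesawA : ∀ π, (∃ g : Fin 4 → G, comp π (D.fOmegaS g) ≠ 0) ↔ (perA π ∧ Θ π ≠ ⊥)
  /-- the same for the B-product. -/
  seesawB : ∀ π, (∃ g : Fin 4 → G, comp π (D.fOmegaSbar g) ≠ 0) ↔ (perB π ∧ Θ π ≠ ⊥)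
  /-- a `π` with non-zero `(T_A, μ_A)`-period has a non-zero theta lift (GQT Thm 1.4(ii) + Sun–Zhu/Moen, F4/F5). -/
  Θ_ne_bot_of_perA : ∀ π, perA π → Θ π ≠ ⊥
  /-- the double cosets `T_A(F)\U(W_A)(F)/T_B(F)`. -/
  Orb : Type
  /-- the two-torus RTF over the datum's spectrum and periods. -/
  sh : RtfShadow Rep Orb perA perB

/-- The obligation shape as a Prop — EQUIVALENT to `RtfConclusion D` on every datum (`realShadow_iff_rtfConclusion`). -/
def RealShadow : Prop := Nonempty (RealShadowData D)

/-- `RealShadow D → RtfConclusion D` (sorry-free): the RTF's two-torus conclusion plus the seesaw identities. -/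
theorem rtfConclusion_of_realShadow (h : RealShadow D) : RtfConclusion D := by
  obtain ⟨R⟩ := h
  obtain ⟨π, hA, hB⟩ := R.sh.exists_twoTorus
  have hΘ : R.Θ π ≠ ⊥ := R.Θ_ne_bot_of_perA π hA
  exact ⟨R.toSeesawData, π, (R.seesawA π).2 ⟨hA, hΘ⟩, (R.seesawB π).2 ⟨hB, hΘ⟩⟩

/-- **THE CHAIN** `RealShadow D → ∃ g, L2 (fOmegaS g) (fOmegaSbar g) ≠ 0` (sorry-free, uniform in `D`). -/
theorem exists_translates_of_realShadow (h : RealShadow D) :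
    ∃ g : Fin 4 → G, D.S.L2 (D.fOmegaS g) (D.fOmegaSbar g) ≠ 0 :=
  exists_translates_of D (rtfConclusion_of_realShadow D h)

/-- clause (i) of the per-datum test, generically: a datum without `RtfConclusion` has no real shadow. -/
theorem not_realShadow_of_not_rtfConclusion (h : ¬ RtfConclusion D) : ¬ RealShadow D :=
  fun hr => h (rtfConclusion_of_realShadow D hr)

/-! ### The converse (crit-1 l. 14886, review/OBJECTION-Line3Shadow-t7-crit-1.ShadowConverse.lean, pasted with credit;
the lead l. 14881 and crit-2 l. 14884 give the same construction): `RealShadow D ↔ RtfConclusion D` on every datum. -/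

open Classical in
/-- the trivial RTF shadow: one label `π₀` carries the whole spectral side, one double coset the whole geometric side
(crit-1). -/
def RtfShadow.trivial {Rep : Type} {PA PB : Rep → Prop} (π₀ : Rep) (hA : PA π₀) (hB : PB π₀) :
    RtfShadow Rep Unit PA PB where
  spec := fun _ π => if π = π₀ then (1 : ℂ) else 0
  spec_summable := fun _ => (hasSum_ite_eq π₀ (1 : ℂ)).summable
  spec_zero_A := fun _ π h => by
    by_cases hπ : π = π₀
    · subst hπ; exact absurd hA h
    · simp [hπ]
  spec_zero_B := fun _ π h => by
    by_cases hπ : π = π₀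
    · subst hπ; exact absurd hB h
    · simp [hπ]
  orb := fun _ _ => 1
  geomSupp := fun _ => {()}
  orb_supp := fun _ γ hγ => absurd (Finset.mem_singleton.2 (Subsingleton.elim γ ())) hγ
  identity := fun _ => by simp [tsum_ite_eq]
  γ₀ := ()
  anti := fun _ _ _ => le_rfl
  shrink := fun γ _ => Subsingleton.elim γ ()
  orb_γ₀ := fun _ => one_ne_zero

/-- a non-zero `Θ π`-component forces `Θ π ≠ ⊥` (crit-1). -/
theorem SeesawData.Θ_ne_bot_of_comp_ne_zero (sw : SeesawData D) (π : sw.Rep) (x : HX) (hx : sw.comp π x ≠ 0) :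
    sw.Θ π ≠ ⊥ := by
  intro hbot
  have := sw.comp_mem π x
  rw [hbot, Submodule.mem_bot] at this
  exact hx this

/-- **THE CONVERSE**: `RtfConclusion D → RealShadow D` on every datum (crit-1): `perA`/`perB` are DEFINED as the left-hand
sides of the seesaw iffs and the shadow is `RtfShadow.trivial`. -/
theorem realShadow_of_rtfConclusion (h : RtfConclusion D) : RealShadow D := by
  obtain ⟨sw, π₀, hA, hB⟩ := h
  exact ⟨{ toSeesawData := sw
           perA := fun π => ∃ g : Fin 4 → G, sw.comp π (D.fOmegaS g) ≠ 0
           perB := fun π => ∃ g : Fin 4 → G, sw.comp π (D.fOmegaSbar g) ≠ 0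
           seesawA := fun π => ⟨fun h => ⟨h, by obtain ⟨g, hg⟩ := h; exact sw.Θ_ne_bot_of_comp_ne_zero D π _ hg⟩,
             fun h => h.1⟩
           seesawB := fun π => ⟨fun h => ⟨h, by obtain ⟨g, hg⟩ := h; exact sw.Θ_ne_bot_of_comp_ne_zero D π _ hg⟩,
             fun h => h.1⟩
           Θ_ne_bot_of_perA := fun π h => by obtain ⟨g, hg⟩ := h; exact sw.Θ_ne_bot_of_comp_ne_zero D π _ hg
           Orb := Unit
           sh := RtfShadow.trivial π₀ hA hB }⟩

/-- `RealShadow D ↔ RtfConclusion D` — the obligation shape is the same Prop as Line 3's conclusion, on every datum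
(crit-1; lead l. 14881; crit-2 l. 14884). -/
theorem realShadow_iff_rtfConclusion : RealShadow D ↔ RtfConclusion D :=
  ⟨rtfConclusion_of_realShadow D, realShadow_of_rtfConclusion D⟩

end Line3

end

end Summit.Ventures.HodgeRepro2.Tier7
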